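import Literature.NumberTheory.LFunctions.Zhang2022.KnifeEdgeLenSiegelModuli
import Literature.NumberTheory.LFunctions.ExceptionalZeroFromSmallLOneProofs

/-!
# Zhang (2022), rung F-S3 (Landau–Siegel programme, §D edge len): «(A) ⇒ a Siegel zero of quality ≫ 𝓛²⁰²¹» is now
# UNCONDITIONAL in the kernel — the two bridges of `KnifeEdgeLenSiegelModuli` Part 5 with their Montgomery–Vaughan
# hypothesis discharged by the tree (`montgomeryVaughan2007_theorem114_dichotomy_holds`, ls-lit-r3 g4, p489249)

Y. Zhang, *Discrete mean estimates and the Landau–Siegel zero*, arXiv:2211.02515v1 [Zhang2022LandauSiegel] — an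
unrefereed manuscript under adjudication. **WHAT THIS IS NOT: not a claim about Theorems 1–2 of arXiv:2211.02515,
about Landau–Siegel zeros, or about Parity. The programme SEARCHES and TYPES; no claim about Landau–Siegel zeros,
Theorems 1–2 of arXiv:2211.02515 or a repaired Margin232 until a kernel theorem says so.** The theorems below are
implications FROM Zhang's Assumption (A) (`L(1,χ) < (log D)⁻²⁰²²`, §2 p. 4) to the existence of a real zero
`β > 1 − C(log D)⁻²⁰²²` of `L(s,χ)` — i.e. (A) puts one in the Siegel-zero world of the tree's Tao–Teräväinen
vocabulary (`Literature.Barriers.Parity.IsSiegelZero χ η`, `η ≥ (log D)²⁰²¹/C`). They were typed CONDITIONALLY on the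
named fact `montgomeryVaughan2007_theorem114_dichotomy` (Montgomery–Vaughan Thm 11.4 at `s = 1`,
`ExceptionalZeroFromSmallLOne.lean`, p467873) in `KnifeEdgeLenSiegelModuli` (`realZero_of_assumptionA h`,
`isSiegelZero_of_assumptionA h`; that file is at the 400-line cap, hence this companion leaf); the fact is now PROVED in
the tree (`ExceptionalZeroFromSmallLOneProofs.montgomeryVaughan2007_theorem114_dichotomy_holds`, from
`DirichletZFR.exists_inv_LFunction_bounds_sharp`), so the hypothesis is discharged here. Consumers: theory's (A)-world
inventory; the CLOSED card `siegel-model-family-index` (reduces-to E-076/E-077/E-002/E-014) used them as infrastructure.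

## References
* Y. Zhang, arXiv:2211.02515v1 (2022), §2 p. 4 (Assumption (A)). [cite: Zhang2022LandauSiegel, §2 p. 4]
* H. L. Montgomery, R. C. Vaughan, *Multiplicative Number Theory I* (2007), Thm 11.4, (11.7)/(11.10).
  [cite: MontgomeryVaughan2007, Theorem 11.4]
-/

noncomputable section

open Real

namespace Literature.NumberTheory.LFunctions.Zhang2022.KnifeEdge

open Skeleton
open Literature.Barriers.Parity (IsSiegelZero)

/-- **(A) forces a real zero near 1 (UNCONDITIONAL, proved):** there is `C > 0` such that for every real primitive `χ`
to every large modulus `D`, Assumption (A) gives a real zero `β < 1` of `L(s,χ)` with `1 − β ≤ C(log D)⁻²⁰²²` —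
`realZero_of_assumptionA` with Montgomery–Vaughan Thm 11.4 supplied by the tree. [cite: Zhang2022LandauSiegel, §2 p. 4]
[cite: MontgomeryVaughan2007, Theorem 11.4] -/
theorem realZero_of_assumptionA_unconditional :
    ∃ C : ℝ, 0 < C ∧ ForAllLarge fun D _ χ => AssumptionA D χ →
      ∃ β : ℝ, β < 1 ∧ 1 - β ≤ C * (1 / Real.log D ^ 2022) ∧ χ.LFunction (β : ℂ) = 0 :=
  realZero_of_assumptionA montgomeryVaughan2007_theorem114_dichotomy_holds

/-- **(A) puts one in the Siegel-zero world, quality `η ≥ (log D)²⁰²¹/C` (UNCONDITIONAL, proved):**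
`isSiegelZero_of_assumptionA` with Montgomery–Vaughan Thm 11.4 supplied by the tree. [cite: Zhang2022LandauSiegel, §2 p. 4]
[cite: MontgomeryVaughan2007, Theorem 11.4] -/
theorem isSiegelZero_of_assumptionA_unconditional :
    ∃ C : ℝ, 0 < C ∧ ForAllLarge fun D _ χ => AssumptionA D χ →
      ∃ η : ℝ, Real.log D ^ 2021 / C ≤ η ∧ IsSiegelZero χ η :=
  isSiegelZero_of_assumptionA montgomeryVaughan2007_theorem114_dichotomy_holds

end Literature.NumberTheory.LFunctions.Zhang2022.KnifeEdge

end
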